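import Mathlib
import HarnessLib

/-!
# The obstruction map and the semiregularity map are mutually transpose (K-trivial varieties): linear-algebra skeleton

Family `hodge`, layer `Literature/AlgebraicGeometry/HodgeTheory`. Companion to `SemiregularityWeakCriterionAbelian.lean`,
`SemiregularSemihomogeneousSimple.lean` (Markman's weak criterion (W) on abelian varieties; [`Markman2025SecantWeilSurvey`,
Lemma 11.3 / Question 11.4]; [Markman, arXiv:2502.03415v2, §8.3, UNREFEREED]) and to the ladder note
`papers/HodgeConjecture/hodge-weil-ladder`, section "Question 11.4″(a) on abelian varieties, III" (`Q114-ABELIAN-III.md`).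

SETTING. `Y` compact Kähler of dimension `n` with `K_Y ≅ 𝒪_Y` (abelian variety, complex torus, Calabi–Yau, hyperkähler), `E` a
coherent sheaf (perfect complex), `HT²(Y) = H²(𝒪) ⊕ H¹(T) ⊕ H⁰(∧²T) ∋ u = (α, ξ, π)`,
`ob_E(u) = α·id_E + ξ⌟at_E + ½ π⌟at_E² ∈ Ext²(E,E)` ([Markman §8.3]; `= ev_E ∘ HKR⁻¹` on abelian varieties, where `HT^*` is
generated by `HT¹` and `ev_E` is multiplicative), and for every `k` the Buchweitz–Flenner-type map
`σ^{(k)}_E : Ext^k(E,E) → HΩ_{−k}(Y) := ⊕_q H^{q+k}(Y, Ω^q)`, `σ^{(k)}(f) = Σ_q tr(at_E^q ∘ f)/q!` (`σ^{(2)} = σ_E` is the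
semiregularity map, `σ^{(0)}(id) = ch(E)`, `σ^{(1)} =: dch_E` is the differential of the Deligne-cohomology-valued Chern character /
generalised Abel–Jacobi map `Ξ = (Ξ_p)_p`, whose tangent map on `Ext¹(E,E)` is `I ∘ σ_{p−1}` in weight `p` [`Pridham2024Semiregularity` =
Forum Math. Sigma 12 (2024) e126, abstract p. 1 ("an analogue of Deligne cohomology") and Prop. 2.20 + Rem. 2.21, §2.3 pp. 17–18 (published numbering;
= arXiv:1208.3111 Prop. 2.12 + Rem. 2.13)]).
Serre duality gives PERFECT pairings `Ext^k(E,E) × Ext^{n−k}(E,E) → H^n(𝒪_Y) ≅ ℂ`, `(x,f) ↦ tr(x∘f)`, and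
`HT^k(Y) × HΩ_{k−n}(Y) → H^{0,n}(Y)`, `(u, η) ↦ [u⌟η]_{(0,n)}` (`H^a(∧^bT)^∨ ≅ H^{n−a}(Ω^b)` since `K_Y` is trivial).

THEOREM T (note §1; elementary: trace is graded-cyclic, commutes with contraction by (poly)vector classes and with cup product by
classes in `H^*(𝒪)`, and `(v₁⌟at)∘⋯∘(v_b⌟at) = (v₁∧⋯∧v_b)⌟at^b/b!` by graded commutativity). For `u ∈ HT^k`, `f ∈ Ext^{n−k}(E,E)`:
    `tr( ev_E(u) ∘ f ) = ± [ u ⌟ σ^{(n−k)}_E(f) ]_{(0,n)}`.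
I.e. `ev_E` on `HT^k` and `σ_E` on `Ext^{n−k}` are MUTUALLY TRANSPOSE for the two Serre pairings. (For `k = 2` the left side uses
only the formula for `ob_E`; on abelian varieties all `k`.) Pairing the Buchweitz–Flenner diagram with `HT^{n−2}` shows that it is
the case `f = ev(w)` of Theorem T: `σ_E ∘ ob_E = ⌟ch(E)` FOLLOWS from T on abelian varieties.

COROLLARIES (note §1, all from "transpose" + perfect pairings; this file checks the linear algebra):
 (T.i)  `rank ob_E = rank σ^{(n−2)}_E`, `ker σ^{(n−2)} = (im ob_E)^⊥`, `ker ob_E = Ann(im σ^{(n−2)}_E)`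
        (`rank_transpose_eq`, `ker_transpose_eq_dualAnnihilator_range`, `ker_eq_dualCoannihilator_range_transpose`);
        likewise `ker(⌟ch(E)) = Ann(HT^{n−2}⌟ch(E)) = Ann(σ^{(n−2)}(ev HT^{n−2}))`. Hence
        (W) :⟺ `ker ob_E = ker ⌟ch(E)`  ⟺  `σ^{(n−2)}(Ext^{n−2}(E,E)) = σ^{(n−2)}(ev_E(HT^{n−2}))`
        ⟺ `Ext^{n−2}(E,E) = ev_E(HT^{n−2}) + ker σ^{(n−2)}`   (`weakCriterion_iff_sup_ker_eq_top`, `map_eq_range_iff_sup_ker_eq_top`).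
 (T.ii) `n = 4` (abelian fourfolds `X × X̂` for `X` an abelian SURFACE — the Weil-fourfold rung of the ladder; HK fourfolds):
        `σ_E = ob_Eᵀ`. Hence  E SEMIREGULAR ⟺ `ob_E = ev_E ∘ HKR⁻¹` SURJECTIVE (`transpose_injective_iff_surjective`): on K-trivial
        fourfolds the surjectivity hypothesis of [`Markman2025SecantWeilSurvey`, Lemma 11.3] is EQUIVALENT to its conclusion and the
        kernel hypothesis is then automatic — this answers the first sentence of Question 11.4 there ("is the surjectivity of `ev_E`
        needed?": it is necessary and sufficient). Moreover (W) ⟺ `im ob_E ∩ (im ob_E)^⊥ = 0` ⟺ `Ext²(E,E) = im ob_E ⊕ ker σ_E` ⟺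
        `im ob_E` is a NONDEGENERATE subspace for the (symmetric) Serre pairing ⟺ `rank σ_E = rank ⌟ch(E)`
        (`inf_orthogonal_eq_bot_iff_sup_eq_top`, `weakCriterion_fourfold_iff_isCompl`).
 (T.iii) `n = 3` (abelian threefolds): `σ_E = (ev_E|_{HT¹})ᵀ` and `ob_E = (dch_E)ᵀ` with
        `dch_E = σ^{(1)} : Ext¹(E,E) → H^{0,1} ⊕ H^{1,2} ⊕ H^{2,3}` = (`d Pic`, `d AJ(ch₂)`, `d Alb(ch₃)`). Hence
        E SEMIREGULAR ⟺ `Ext¹(E,E) = ev_E(HT¹(Y))` (E is infinitesimally rigid modulo translations and `Pic⁰`-twists);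
        `dim ker σ_E = ext¹(E,E) − dim ev_E(HT¹)` = number of "exotic" first-order deformations;
        (W) ⟺ `dch_E(Ext¹(E,E)) = dch_E(ev_E(HT¹))` ⟺ every first-order deformation of `E` is, modulo the group `Y × Ŷ`,
        infinitesimally trivial in Deligne cohomology (Pic⁰ × J²(Y) × Alb(Y)); (W_T) ⟺ the same for the `H^{1,2}` (Abel–Jacobi)
        component. For an lci CURVE `F ⊂ Y` and `E = I_F`: semiregular ⟺ `h⁰(N_{F/Y}) = 3`; (W) ⟺ all embedded first-order
        deformations of `F` have Abel–Jacobi and `Alb(K_F)`-derivative inside those of translations.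
 (T.iv) `n = 2`: `ob_E = (σ^{(0)})ᵀ`, `σ^{(0)}(φ) = tr(exp(at_E)∘φ) = "ch(φ)"` on `End(E)`: (W) ⟺ `ch(End E) = ch(ev(HT⁰)) = ℂ·ch(E)`
        — the gen-6 Lemma N / Proposition U (`SemiregularityWeakCriterionK3.lean`: nilpotent endomorphisms have `ch(φ) = 0`) are
        the instances used for the K3 and rational-surface counterexamples.
 NEW (W)-SHEAVES ON ABELIAN THREEFOLDS that are NOT semiregular (note §3; each answers the first sentence of Q. 11.4 in the sense
 "surjectivity fails, (W) holds, the conclusion of Thm 2.1 holds or is open"): ideal sheaves `I_Z` of 0-dimensional `Z`, `ℓ(Z) ≥ 2`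
 (`dch(T_Z Hilb) = d(sum) ⊆ d(sum)(translations)`; survive trivially: `points_not_semiregular`); CLEAN MEMBERS OF PENCILS `|F|` on a
 smooth surface `D ∈ |N|` in `Y` (`h⁰(N_{F/Y}) = 4`: `dch` kills the pencil direction because the members are rationally equivalent
 and `K_{F_λ} = N·F_λ` in `CH₀(Y)` by adjunction; Serre bundle `𝒱`, `h⁰(𝒱) = 2`, `χ(𝒱) = h⁰(N) + 1 − g(F)`; survival OPEN =
 residual (ε″) of the note; `serreBundle_euler_nonpos`, `jumpLocus_expected_codim`, and the bielliptic-genus-3 example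
 `bielliptic_pencil_*`: `Θ = C^{(2)} ⊂ J(C)`, pencil `{x+y : π(x) − π(y) = ±d}`, `g(F) = 9`, `[F] = 4θ² − 2θε = ¼(4θ − ε)²`,
 `(4θ−ε)³ = 192`, `(2θ−ε)³ = 0`).
 SURVIVAL ON ABELIAN THREEFOLDS (note §2): (δ) if the reduced moduli germ of `E` (resp. the reduced Hilbert germ of an lci curve `F`)
 is the orbit (`E` "isolated modulo the group") and `ob_E(ξ₀) = 0`, then `E` extends along every arc `B ⊂ NL(ch E)` tangent to
 `ξ₀` after a finite base change: the relative functor has tangent dimension `ext¹ + 1` and a complete obstruction space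
 `ker σ_E` of dimension `ext¹ − dim(orbit)` [`Pridham2024Semiregularity`, §2.5; Bloch for curvilinear steps], so every component
 of its hull has dimension `≥ dim(orbit) + 1 >` dimension of the central fibre (`component_dim_exceeds_orbit`); (γ) on the CLEAN
 locus of a family `Z` of sheaves the obstruction sheaf along Hodge-locus arcs is `Ω¹_Z` (threefold duality; the Clemens–Kley
 mechanism [`Kley1998CurvesKtrivial`]); an everywhere-clean pencil (`Z ≅ ℙ¹`) survives wholesale and untwisted along every arc of
 `NL([F])` (`H⁰(ℙ¹,Ω¹) = 0 = H¹(ℙ¹, 𝒪(2) ⊕ 𝒪³)`); LEMMA (curve classes polarise): for a generating curve `F` in a complex torus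
 of dimension `n`, `NL([F]) = NL(L_F)` for a rational POLARISATION `L_F` with `[F] ∈ ℚ_{>0}·L_F^{n−1}` (the symplectic inverse of
 `[F] ∈ H₂ = ∧²Λ`; `vandermonde_HT_two` records `dim HT² = dim HΩ_{2−n} = C(2n,2)`), so tori stay projective along `NL([F])`.
WHAT IS KERNEL-CHECKED HERE: def-free linear algebra of transposes / annihilators / nondegenerate subspaces over a field, and the
arithmetic of the examples; the identifications with `ob_E`, `σ_E`, `dch_E`, `NL` are paper-level (note §§1–4).
References: [`BuchweitzFlenner2003`]; [`Pridham2024Semiregularity`]; [`Markman2025SecantWeilSurvey`]; [`Bloch1972Semiregularity`];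
[`Kley1998CurvesKtrivial`] (H. Kley, "On the existence of curves in K-trivial threefolds", alg-geom/9811099; with Clemens–Kley,
"Counting curves that move with threefolds", J. Alg. Geom. 9 (2000)); [`LangeBirkenhake1992`, §§5.2–5.3, 12.2, 14.4].
-/

namespace Literature.AlgebraicGeometry.HodgeTheory.SemiregularityTransposeDuality

open Module

section Transpose

variable {K : Type*} [Field K] {U X : Type*} [AddCommGroup U] [Module K U] [AddCommGroup X] [Module K X]

/-- (T.i) `rank ob_E = rank σ^{(n−2)}_E`: a linear map and its transpose have the same rank. In particular on a K-trivial
FOURFOLD `rank ob_E = rank σ_E`, and on a threefold `rank σ_E = dim ev_E(HT¹)`. [folklore] -/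
theorem rank_transpose_eq (f : U →ₗ[K] X) :
    finrank K (LinearMap.range f.dualMap) = finrank K (LinearMap.range f) :=
  LinearMap.finrank_range_dualMap_eq_finrank_range f

/-- (T.ii) On a K-trivial fourfold `σ_E = ob_Eᵀ`, so `E` is SEMIREGULAR (`σ_E` injective) iff `ob_E = ev_E ∘ HKR⁻¹ : HT²(Y) →
Ext²(E,E)` is SURJECTIVE: the surjectivity hypothesis of [`Markman2025SecantWeilSurvey`, Lemma 11.3] is equivalent to its
conclusion there, and the kernel hypothesis is then automatic. On a threefold (with `f = ev_E|_{HT¹}`, `fᵀ = σ_E`): semiregular iff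
`Ext¹(E,E) = ev_E(HT¹)`. [folklore] -/
theorem transpose_injective_iff_surjective (f : U →ₗ[K] X) :
    Function.Injective f.dualMap ↔ Function.Surjective f :=
  LinearMap.dualMap_injective_iff

/-- (T.i) `ker σ^{(n−2)}_E = (im ob_E)^⊥`: the kernel of the transpose is the annihilator of the image. (n = 3 with `f = ev|_{HT¹}`:
`ker σ_E = ev_E(HT¹)^⊥ ⊂ Ext²(E,E) = Ext¹(E,E)^∨`.) [folklore] -/
theorem ker_transpose_eq_dualAnnihilator_range (f : U →ₗ[K] X) :
    LinearMap.ker f.dualMap = (LinearMap.range f).dualAnnihilator :=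
  LinearMap.ker_dualMap_eq_dualAnnihilator_range f

/-- (T.i) `ker ob_E = Ann(im σ^{(n−2)}_E)`: the kernel of a map is the (co)annihilator of the image of its transpose. With
`f = ob_E`, `fᵀ = σ^{(n−2)}`; on a threefold `ker ob_E = Ann(dch_E(Ext¹(E,E)))` (note §1, Cor. T3). [folklore] -/
theorem ker_eq_dualCoannihilator_range_transpose (f : U →ₗ[K] X) :
    LinearMap.ker f = (LinearMap.range f.dualMap).dualCoannihilator := by
  rw [LinearMap.range_dualMap_eq_dualAnnihilator_ker, Subspace.dualAnnihilator_dualCoannihilator_eq]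

/-- Two nested subspaces of the dual have the same coannihilator iff they are equal (finite dimension). Used with
`Φ = σ(ev HT^{n−2}) ≤ Ψ = σ(Ext^{n−2})`: (W) `⟺ ker ⌟ch(E) = ker ob_E ⟺ Φ^⊥ = Ψ^⊥ ⟺ Φ = Ψ`. [folklore] -/
theorem dualCoannihilator_eq_iff_eq_of_le [FiniteDimensional K U] {Φ Ψ : Subspace K (Module.Dual K U)} (h : Φ ≤ Ψ) :
    Φ.dualCoannihilator = Ψ.dualCoannihilator ↔ Φ = Ψ := by
  refine ⟨fun heq => ?_, fun heq => by rw [heq]⟩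
  apply Submodule.eq_of_le_of_finrank_eq h
  have h1 := Subspace.finrank_add_finrank_dualCoannihilator_eq Φ
  have h2 := Subspace.finrank_add_finrank_dualCoannihilator_eq Ψ
  rw [heq] at h1
  omega

end Transpose

section WeakCriterion

variable {K : Type*} [Field K] {E₁ D : Type*} [AddCommGroup E₁] [Module K E₁] [AddCommGroup D] [Module K D]

/-- `d(P) = d(Ext¹)` iff `Ext¹ = P + ker d`: with `d = dch_E` (or `σ^{(n−2)}`) and `P = ev_E(HT^{n−2})`, the weak criterion (W) on a
K-trivial `n`-fold reads `Ext^{n−2}(E,E) = ev_E(HT^{n−2}) + ker σ^{(n−2)}`; for `n = 3`: every first-order deformation of `E` is,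
modulo the orbit of `Y × Ŷ`, infinitesimally trivial in Deligne cohomology (note §1, Cor. T3). [folklore] -/
theorem map_eq_range_iff_sup_ker_eq_top (d : E₁ →ₗ[K] D) (P : Submodule K E₁) :
    P.map d = LinearMap.range d ↔ P ⊔ LinearMap.ker d = ⊤ := by
  constructor
  · intro h
    rw [← Submodule.comap_map_eq d P, h]
    exact eq_top_iff.2 fun x _ => LinearMap.mem_range_self d x
  · intro h
    apply le_antisymm (LinearMap.map_le_range)
    rintro _ ⟨x, rfl⟩
    have hx : x ∈ P ⊔ LinearMap.ker d := h ▸ Submodule.mem_top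
    obtain ⟨p, hp, k, hk, rfl⟩ := Submodule.mem_sup.1 hx
    exact ⟨p, hp, by rw [map_add, LinearMap.mem_ker.1 hk, add_zero]⟩

variable [FiniteDimensional K D]

/-- THE WEAK CRITERION AS AN IMAGE CONDITION (note §1, Cor. T1/T3). Model: `d : Ext^{n−2}(E,E) → HΩ_{2−n}(Y) ≅ (HT²)^∨` the map
`σ^{(n−2)}` (for `n = 3`: `dch_E` on `Ext¹`), `P = ev_E(HT^{n−2}) ≤ Ext^{n−2}`. By Theorem T, `ker ob_E = Ann(im d)` and
`ker ⌟ch(E) = Ann(d(P))`; so  (W) [`ker ob_E = ker ⌟ch(E)`]  ⟺  `Ann(im d) = Ann(d P)`  ⟺  `P + ker d = ⊤`. [folklore] -/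
theorem weakCriterion_iff_sup_ker_eq_top (d : E₁ →ₗ[K] Module.Dual K D) (P : Submodule K E₁) :
    (LinearMap.range d).dualCoannihilator = (P.map d).dualCoannihilator ↔ P ⊔ LinearMap.ker d = ⊤ := by
  rw [eq_comm, dualCoannihilator_eq_iff_eq_of_le (LinearMap.map_le_range), map_eq_range_iff_sup_ker_eq_top]

end WeakCriterion

section Fourfold

variable {K : Type*} [Field K] {X : Type*} [AddCommGroup X] [Module K X] [FiniteDimensional K X]

/-- (T.ii), K-trivial FOURFOLDS. `B` = the symmetric (reflexive) nondegenerate Serre pairing on `Ext²(E,E)`, `W = im ob_E`,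
`W^⊥ = ker σ_E` (Theorem T). Then  `W ∩ W^⊥ = 0`  ⟺  `W + W^⊥ = Ext²`: the weak criterion (W) ("`σ_E` injective on `im ob_E`")
holds iff `Ext²(E,E) = im ob_E ⊕ ker σ_E` iff `rank σ_E = rank(⌟ch(E))`. [folklore] -/
theorem inf_orthogonal_eq_bot_iff_sup_eq_top {B : LinearMap.BilinForm K X} (hB : B.Nondegenerate) (hB₀ : B.IsRefl)
    (W : Submodule K X) : W ⊓ B.orthogonal W = ⊥ ↔ W ⊔ B.orthogonal W = ⊤ := by
  constructor
  · intro h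
    exact ((LinearMap.BilinForm.isCompl_orthogonal_iff_disjoint hB₀).2 (disjoint_iff.2 h)).sup_eq_top
  · intro h
    have hdim := Submodule.finrank_sup_add_finrank_inf_eq W (B.orthogonal W)
    rw [h, finrank_top, LinearMap.BilinForm.finrank_orthogonal hB] at hdim
    have hle : finrank K W ≤ finrank K X := Submodule.finrank_le W
    have h0 : finrank K ↥(W ⊓ B.orthogonal W) = 0 := by omega
    exact Submodule.finrank_eq_zero.1 h0

/-- (T.ii) … equivalently `im ob_E` is a nondegenerate subspace for the Serre pairing, i.e. a complement of `ker σ_E`. [folklore] -/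
theorem weakCriterion_fourfold_iff_isCompl {B : LinearMap.BilinForm K X} (hB₀ : B.IsRefl) (W : Submodule K X) :
    W ⊓ B.orthogonal W = ⊥ ↔ IsCompl W (B.orthogonal W) := by
  rw [LinearMap.BilinForm.isCompl_orthogonal_iff_disjoint hB₀, disjoint_iff]

end Fourfold

section Threefold

/-- The duality `HT²(Y) ≅ HΩ_{2−n}(Y)^∨` on a K-trivial `n`-fold is dimensionally consistent:
`dim HΩ_{2−n} = Σ_{q=0}^{2} C(n,q)·C(n,2−q) = C(2n,2) = dim HT²` (Vandermonde). [folklore] -/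
theorem vandermonde_HT_two (n : ℕ) :
    ∑ ij ∈ Finset.HasAntidiagonal.antidiagonal (2 : ℕ), n.choose ij.1 * n.choose ij.2 = (2 * n).choose 2 := by
  rw [two_mul, Nat.add_choose_eq]

/-- SURVIVAL (δ) on abelian threefolds (note §2, Thm. A3): `e = ext¹(E,E)`, `o = dim ev_E(HT¹)` (orbit dimension), `k = dim ker σ_E
= e − o` (Theorem T). The relative deformation functor of `E` along an arc `B ⊂ NL(ch E)` tangent to a liftable direction has
tangent dimension `e + 1` and complete obstruction space `ker σ_E` [`Pridham2024Semiregularity`, §2.5], so each component of its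
hull has dimension `≥ e + 1 − k = o + 1`, which EXCEEDS the dimension `o` of the central fibre when `E` is isolated modulo the group:
some component dominates `B`, i.e. `E` extends after a finite base change. [folklore] -/
theorem component_dim_exceeds_orbit (e o k : ℕ) (h : e = o + k) : o < e + 1 - k ∧ e + 1 - k = o + 1 := by
  subst h
  omega

/-- `I_Z` for a smoothable (e.g. reduced) 0-dimensional `Z ⊂ Y` of length `ℓ ≥ 2` on an abelian threefold is a (W)-sheaf that is
NOT semiregular: `dim T_Z Hilb^ℓ(Y) ≥ 3ℓ > 3 = dim V` (so `Ext¹ ≠ ev(HT¹)`), while `dch` of every embedded deformation is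
`(0, 0, d(sum of points)) ∈ dch(V)` (note §3(a)); it survives along every deformation (local triviality). [folklore] -/
theorem points_not_semiregular (ℓ t : ℕ) (hℓ : 2 ≤ ℓ) (ht : 3 * ℓ ≤ t) : 3 < t := by
  omega

end Threefold

section Pencils

/-- Serre bundle of a pencil `|F|` on a smooth surface `D ∈ |N|` in an abelian threefold (`0 → 𝒪 → 𝒱 → I_F ⊗ N → 0`,
`h⁰(𝒱) = 2`): `χ(𝒱) = χ(N) − χ(N|_F) = h⁰(N) − (2g−2+1−g) = h⁰(N) + 1 − g`, NONPOSITIVE as soon as `g ≥ h⁰(N) + 1` (e.g. any pencil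
of genus `≥ 2` curves on a theta divisor). [folklore] -/
theorem serreBundle_euler_nonpos (h0N g : ℤ) (hg : h0N + 1 ≤ g) :
    h0N - ((2 * g - 2) + 1 - g) = h0N + 1 - g ∧ h0N + 1 - g ≤ 0 := by
  constructor <;> omega

/-- … and then the locus `{h⁰(𝒱_t ⊗ P) ≥ 2}` in the 4-dimensional space `B × Ŷ_t` has expected codimension `2·(2 − χ(𝒱)) ≥ 4`:
the pencil is EXPECTED to disappear along a general arc `B ⊂ NL(ch 𝒱)` (note §4, the heuristic behind residual (ε″)). [folklore] -/
theorem jumpLocus_expected_codim (χ : ℤ) (hχ : χ ≤ 0) : 4 ≤ 2 * (2 - χ) := by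
  omega

/-- Bielliptic genus-3 example (note §3(c)): `C → E` a double cover with 4 branch points, `J = J(C) ∼ E × P`, `θ` principal,
`ε = Nm^*[pt]`; intersection numbers `θ³ = 6`, `θ²ε = (θ|_P)² = 4` (type (1,2)), `θε² = ε³ = 0`. Then `M = 2θ − ε` is the nef
boundary (`M³ = 0`, pulled back from `J/E`) and `L_F = 4θ − ε` is AMPLE with `L_F³ = 192`, `L_F²θ = 64`, `L_Fθ² = 20`. [folklore] -/
theorem bielliptic_pencil_cubes (t3 t2e te2 e3 : ℤ) (h3 : t3 = 6) (h2 : t2e = 4) (h1 : te2 = 0) (h0 : e3 = 0) :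
    8 * t3 - 12 * t2e + 6 * te2 - e3 = 0 ∧ 64 * t3 - 48 * t2e + 12 * te2 - e3 = 192 ∧
      16 * t3 - 8 * t2e + te2 = 64 ∧ 4 * t3 - t2e = 20 := by
  subst h3 h2 h1 h0
  norm_num

/-- … the pencil `F_d = {x + y ∈ C^{(2)} : π(x) − π(y) = ±d}` on `Θ = C^{(2)}`: `F̃_d → C` is a double cover with `4·2 = 8`
ramification points, so `2g(F) − 2 = 2·(2·3 − 2) + 8 = 16`, `g(F) = 9`; `F·ε = 16` (count `(8·4)/2`) and, by adjunction on `Θ`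
(`K_Θ = θ|_Θ`, `F² = 0`), `F·θ = 2g − 2 = 16`. Writing `[F] = a·θ²/2 + b·θε` with `(θ²/2)·ε = 2`, `(θ²/2)·θ = 3`, `θε·θ = 4`,
`θε·ε = 0`:  `2a = 16`, `3a + 4b = 16`  ⟹  `a = 8`, `b = −2`, i.e. `[F_d] = 4θ² − 2θε`. [folklore] -/
theorem bielliptic_pencil_class (a b : ℤ) (hε : 2 * a + 0 * b = 16) (hθ : 3 * a + 4 * b = 16) :
    a = 8 ∧ b = -2 ∧ (2 * 9 - 2 : ℤ) = 2 * (2 * 3 - 2) + 8 := by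
  refine ⟨by omega, by omega, by norm_num⟩

/-- … and `[F_d] = 4θ² − 2θε = ¼(4θ − ε)²` in `H⁴(J,ℚ)` (using `ε² = 0`): the class of the pencil member is a positive multiple of
the square of the AMPLE class `L_F = 4θ − ε`, so `NL([F_d]) = NL(L_F)` is a 6-dimensional family of POLARISED abelian threefolds
(LEMMA "curve classes polarise", note §2), strictly larger than the 4-dimensional bielliptic/`E × P` locus `NL(θ, ε)` and meeting
the Siegel germ `NL(θ)` exactly in it. [folklore] -/
theorem bielliptic_pencil_square {R : Type*} [CommRing R] (θ ε : R) (hε : ε * ε = 0) :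
    (4 * θ - ε) ^ 2 = 4 * (4 * θ ^ 2 - 2 * (θ * ε)) := by
  have : ε ^ 2 = 0 := by rw [sq, hε]
  ring_nf
  rw [this]
  ring

/-- SURVIVAL (γ) for an everywhere-clean pencil (note §2, Thm. P¹): on `Λ = ℙ¹` the reduced obstruction sheaf is
`ker(π : R¹p_*N → H^{1,3} ⊗ 𝒪) ≅ L_q^∨ ≅ 𝒪(−2 − z)` (`L_q = p_*N/(V ⊗ 𝒪) ⊇ T_{ℙ¹}`, `z ≥ 0`), which has no sections, and the
gluing torsor lives in `H¹(ℙ¹, p_*N)`, squeezed between `H¹(𝒪³) = 0` and `H¹(𝒪(2 + z)) = 0` (`2 + z ≥ −1`): every member extends,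
untwisted, to all orders and then analytically (Artin approximation) along every arc of `NL([F])`. [folklore] -/
theorem pencil_cohomology_vanishing (z : ℕ) : -2 - (z : ℤ) < 0 ∧ -1 ≤ 2 + (z : ℤ) := by
  constructor <;> omega

end Pencils

section BiellipticLattice

/-!
### The bielliptic pencil integrally (note §3(c), §4; appended)

In a `θ`-symplectic basis `e₁,e₂,e₃,f₁,f₂,f₃` of `Λ = H₁(J(C),ℤ)` with `H₁(E₀) = ⟨e₁+e₂, f₁+f₂⟩`, `H₁(P) = ⟨e₁−e₂, f₁−f₂, e₃, f₃⟩`: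
`[C] = Σ eᵢ∧fᵢ`, `[E₀] = (e₁+e₂)∧(f₁+f₂)`, `ε = (e₁^*+e₂^*)∧(f₁^*+f₂^*)`, and `[F] = 4[C] + 2[E₀]` (from `F·θ = 16`, `F·ε = 16`), whose
matrix block is `A_F = [[6,2,0],[2,6,0],[0,0,4]]`; `L_F = 4θ − ε` has block `A_L = [[3,−1,0],[−1,3,0],[0,0,4]]` (`A_F·A_L = 16·I`, i.e. `A_L = 16·A_F⁻¹`: Lemma POL).
Smith normal forms from `d₁ = gcd(entries)`, `d₁d₂ = gcd(2×2 minors)`, `d₁d₂d₃ = det`: `A_F ~ (2,4,16)` (the curve class is TWICE a primitive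
class of type (1,2,8)) and `A_L ~ (1,4,8)` (`L_F` primitive of type (1,4,8), `h⁰(L_F) = 32`). Pontryagin products `[C]⋆[C] = 2θ`,
`[C]⋆[E₀] = 2θ − ε`, `[E₀]⋆[E₀] = 0` give, for `[Γ′] = p[C] + q[E₀]`, `mθ + [F]⋆[Γ′] = (m + 12p + 8q)θ − (2p + 4q)ε`, proportional to
`4θ − ε` iff `m = 8q − 4p` (scenario (I) of the note: minimal `(p,q,m) = (0,1,8)`, swept class `4L_F`).
-/

/-- `[F] = a[C] + b′[E₀]` with `θ`-degree `3a + 2b′ = 16` and `ε`-degree `2a + 4b′ = 16` gives `(a,b′) = (4,2)`. [folklore] -/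
theorem bielliptic_class_integral (a b : ℤ) (hθ : 3 * a + 2 * b = 16) (hε : 2 * a + 4 * b = 16) : a = 4 ∧ b = 2 := by
  constructor <;> omega

/-- Smith data of `A_F = [[6,2,0],[2,6,0],[0,0,4]]`: `gcd(entries) = 2`, `gcd(2×2 minors) = gcd(32,24,8) = 8`, `det = 128`, hence
elementary divisors `(2, 8/2, 128/8) = (2,4,16)`; and of `A_L = [[3,−1,0],[−1,3,0],[0,0,4]]`: `gcd(entries) = 1`, `gcd(minors) =
gcd(8,12,4) = 4`, `det = 32`, divisors `(1,4,8)`. [folklore] -/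
theorem bielliptic_smith_data :
    Int.gcd (Int.gcd 6 2) 4 = 2 ∧ Int.gcd (Int.gcd 32 24) 8 = 8 ∧ (6 * 6 - 2 * 2) * 4 = (128 : ℤ) ∧ (128 : ℤ) / 8 = 16 ∧
    Int.gcd (Int.gcd 3 1) 4 = 1 ∧ Int.gcd (Int.gcd 8 12) 4 = 4 ∧ (3 * 3 - 1 * 1) * 4 = (32 : ℤ) ∧ (32 : ℤ) / 4 = 8 := by
  refine ⟨by decide, by decide, by norm_num, by norm_num, by decide, by decide, by norm_num, by norm_num⟩

/-- `A_L = 16 · A_F⁻¹` on the `2×2` block: `[[6,2],[2,6]] · [[3,−1],[−1,3]] = 16·I` and `4 · 4 = 16`, i.e. `A_F · A_L = 16·I₃`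
(so `L_F ∝ [F]⁻¹`, Lemma POL (ii) numerically). [folklore] -/
theorem bielliptic_inverse_block :
    (6 * 3 + 2 * (-1) = (16 : ℤ)) ∧ (6 * (-1) + 2 * 3 = (0 : ℤ)) ∧ (2 * 3 + 6 * (-1) = (0 : ℤ)) ∧ (2 * (-1) + 6 * 3 = (16 : ℤ)) ∧
      (4 * 4 = (16 : ℤ)) := by
  norm_num

/-- Scenario (I) class constraint (note §4): `mθ + [F]⋆[Γ′] = (m + 12p + 8q)θ − (2p + 4q)ε` is proportional to `4θ − ε` iff
`m + 12p + 8q = 4(2p + 4q)`, i.e. `m = 8q − 4p`; with `m ≥ 1`, `p ≥ 0` the minimal solution is `(p,q,m) = (0,1,8)` with coefficient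
`2p + 4q = 4` (swept class `4L_F`). [folklore] -/
theorem scenarioI_constraint (m p q : ℤ) :
    (m + 12 * p + 8 * q = 4 * (2 * p + 4 * q) ↔ m = 8 * q - 4 * p) ∧ ((8 : ℤ) * 1 - 4 * 0 = 8 ∧ (2 : ℤ) * 0 + 4 * 1 = 4) := by
  refine ⟨by omega, by norm_num, by norm_num⟩

end BiellipticLattice

section CensusCounts

/-!
### Computed census numbers (note §3(a), §3(c), §4; appended)

(1) `cleanness.py` (HOME/b2b-hweil-pv1-g9/; bidouble-cover model `w² = ℓ(P)`, `w′² = ℓ(P − d)` of `F̃_d → E`, ranks over `𝔽_p` at random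
parameters, 12/12 instances, `p ∈ {10007, 30011, 100003}`): `rank(μ_W : W ⊗ H⁰(ω_F) → H⁰(ω_F²)) = 23` with `dim W ⊗ H⁰(ω_F) = 3·9 = 27`, hence
`h⁰(N_{F_d/J}) = 27 − 23 = 4`: the general member of the bielliptic pencil is CLEAN (one exotic direction). (2) `hodgelocus.py`: `rank(W·H^{1,0}(K))
= 17`, so the Hodge locus `Z_Λ ⊂ Def(F̃_d)` (`dim Def = 3·9 − 3 = 24`) of the sub-Hodge structure `s^*H¹(J)` has Zariski tangent dimension
`24 − 17 = 7 = dim NL(L_F) + 1` while its expected dimension is `24 − (6−3)(9−3) = 6`; 11.4″(a) at `I_{F_d}` ⟺ `Z_Λ` has excess dimension 7 there.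
(3) `I_Z` for `ℓ` reduced points on an abelian FOURFOLD: `χ(I_Z,I_Z) = −2ℓ`, `ext⁰ = ext⁴ = 1`, `ext¹ = ext³ = 4 + 4ℓ`, so `ext² = 6 + 6ℓ`
(`= 18` for `ℓ = 2`), while `rank ob_E = dim HT² − dim H¹(T) = 28 − 16 = 12 = rank ⌟ch(I_Z)`: (W) holds (T4(b)) and `I_Z` is not semiregular
(`12 < 18`, T4(a)), yet deforms with `Y` along every deformation.
-/

/-- (1)+(2): `27 − 23 = 4` exotic-plus-translation count and `24 − 17 = 7 = 6 + 1`, `24 − 3·6 = 6` (tangent vs expected dimension of the Hodge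
locus `Z_Λ` at `[F̃_d]`). [folklore] -/
theorem bielliptic_census_counts :
    27 - 23 = 4 ∧ 3 * 9 = 27 ∧ 3 * 9 - 3 = 24 ∧ 24 - 17 = 7 ∧ 7 = 6 + 1 ∧ 24 - (6 - 3) * (9 - 3) = 6 := by
  norm_num

/-- (3): on an abelian fourfold, `I_Z` for `ℓ ≥ 1` reduced points has `ext²(I_Z,I_Z) = 6 + 6ℓ` (from `1 − (4+4ℓ) + e₂ − (4+4ℓ) + 1 = −2ℓ`) and
`rank ob = 28 − 16 = 12`; for `ℓ ≥ 2`, `12 < 6 + 6ℓ`: (W) without semiregularity, with survival. [folklore] -/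
theorem points_fourfold_counts (ℓ e₂ : ℤ) (hχ : 1 - (4 + 4 * ℓ) + e₂ - (4 + 4 * ℓ) + 1 = -2 * ℓ) (hℓ : 2 ≤ ℓ) :
    e₂ = 6 + 6 * ℓ ∧ (28 : ℤ) - 16 = 12 ∧ 12 < e₂ := by
  refine ⟨by omega, by norm_num, by omega⟩

end CensusCounts

end Literature.AlgebraicGeometry.HodgeTheory.SemiregularityTransposeDuality
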